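import Summits.QuantumFields.BalabanUV.Beta.GAN24.DerivativeRateTransferJensenMassFreeEnd

/-!
# `BalabanUV.Beta.GAN24.DerivativeRateTransferJensenMassFreeLocal` — binder row G-an2-4 ∕ (CONV-C), route R6 «VALUES, NOT DERIVATIVES», PART 61:
# THE POLAR MASS-FREE END WITH SUPPORT-LOCAL LETTERS — PART 52's mass-datum bound and PART 53's polar mass datum RE-TYPED with the pointwise
# root-frame defect letter `hN` required ONLY AT SITES OF POSITIVE BLOCK WEIGHT (`q(src′e′,x) ≠ 0`), which is all the q-weighted sums ever see; the
# off-block values of the block transporters `W(y,·)` are unconstrained data and on the torus no choice makes their loops small, so the lattice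
# instance (PART 62) needs exactly this form (unit b2b-balaban-gan24-p3, gen 44; v1)

NOT IN PRINT; OUR PROOF (for the ROUTE; [folklore] — PART 52 ∕ 53's proofs VERBATIM with one change each: the pointwise defect family is TRUNCATED off the
support of the weights (`N̂ = [q ≠ 0]·N`, `V̂ = [q ≠ 0]·V + [q = 0]·1`) before PART 47's Jensen lemma `dotProduct_self_wsum_defect_le` resp. PART 52's polar
mass lemma `meanDefect_sq_le_wmoment` is invoked; every q-weighted sum is unchanged).  HONEST FRAMING (cell contract, verbatim): «discharging `BetaPertH`
makes Bałaban's UV stability UNCONDITIONAL — a real constructive-QFT result; it is NOT the continuum limit and NOT the Clay problem.»  HONEST DEPENDENCY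
(verbatim): «continuum YM on T⁴ ⇐ BetaPertH ∧ nine spine estimates (0/9 proved); BetaPertH ⇐ (D1) ∧ (D4) ∧ CAP+tail; G-an2-4 gates asym, D1 and NE2/3/4.»

WHY THIS FILE.  PART 53 `covJensen_polar_massFree` ∕ PART 54 `…_lattice` ∕ PART 57 `…_of_loops` quantify `hN : |N(e′,x)w|² ≤ κ²|w|²` (and PART 57's loop
letter) over ALL fine sites `x`, including those outside the block `src′e′` where `q(src′e′,x) = 0`.  On PART 24's lattice a consumer defines `W y x` by
Bałaban's contour inside the block `y` and ARBITRARILY outside; the off-block root-frame loops then run through arbitrary data, and making them small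
for all `d` bond directions at once is a coarse gauge-equivalence problem with holonomy obstructions — not dischargeable.  Every USE of `hN` in PARTs
47 ∕ 52 ∕ 53 is q-weighted, so the statements can be localised without touching the mechanism: (§1) **`dotProduct_self_wsum_defect_le_local`**,
**`meanDefect_sq_le_wmoment_local`** (the two lemmas through which `hN` enters, with `hN` ∕ `hV` asked only where `q ≠ 0`); (§2)
**`sum_coarseDiff_sq_le_massDatum_local`** = PART 52's bound; (§3) **`massDatum_polar_le_local`** = PART 53's polar mass datum — both with
`hN : ∀ e′ x, q(src′e′,x) ≠ 0 → ∀ w, |N(e′,x)w|² ≤ κ²|w|²`.  PART 62 assembles the support-local polar END, its loop form and the lattice END.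

WHAT THIS FILE PROVES (0 sorry, 0 `def`, nothing cited): §1 `dotProduct_self_wsum_defect_le_local`, `meanDefect_sq_le_wmoment_local`; §2
**`sum_coarseDiff_sq_le_massDatum_local`**; §3 **`massDatum_polar_le_local`**.
WHAT IT DOES NOT DO: change PARTs 52 ∕ 53 (their global forms stand), instantiate anything of Bałaban's, or claim (CONS) ∕ exact (STAB).  SUPPLIER work on
route R6 (rank 2, REDUCTION, no seat); no consumer of record; NEVER «G-an2-4 closed»; NOT (CONV-C), NOT D1, NOT `BetaPertH`, NOT continuum, NOT Clay.
Records: `HOME/b2b-balaban-gan24-p3/WOODBURY-FIBRE.md` v14.4. -/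

noncomputable section

open Matrix Finset

namespace Summit.QuantumFields.BalabanUV.Beta.GAN24.DerivativeRateTransferJensenMassFreeLocal

open Summit.QuantumFields.BalabanUV.Beta.GAN24.DerivativeRateTransferLoewnerKKT (mulVec_dotProduct_eq)
open Summit.QuantumFields.BalabanUV.Beta.GAN24.DerivativeRateTransferJensenChain
open Summit.QuantumFields.BalabanUV.Beta.GAN24.DerivativeRateTransferJensen
open Summit.QuantumFields.BalabanUV.Beta.GAN24.DerivativeRateTransferJensenMeanZero
open Summit.QuantumFields.BalabanUV.Beta.GAN24.DerivativeRateTransferJensenMassFree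
open Summit.QuantumFields.BalabanUV.Beta.GAN24.DerivativeRateTransferJensenMassFreeEnd

/-! ## §1 The two entry points of `hN`, localised to the support of the weights -/

section Tools

variable {o : Type*} [Fintype o] [DecidableEq o]

omit [DecidableEq o] in
/-- **`dotProduct_self_wsum_defect_le_local`** — PART 47's Jensen-against-defects with `hN` asked only where `q_x ≠ 0`:
`|Σ_x q_x·N_x v_x|² ≤ κ²·Σ_x q_x|v_x|²` (truncate `N` to `0` off the support; the sums do not change). [folklore] -/
theorem dotProduct_self_wsum_defect_le_local {ν : Type*} (s : Finset ν) {q : ν → ℝ} (hq : ∀ x ∈ s, 0 ≤ q x) (hq1 : ∑ x ∈ s, q x ≤ 1)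
    {N : ν → Matrix o o ℝ} {κ : ℝ} (hN : ∀ x ∈ s, q x ≠ 0 → ∀ w : o → ℝ, (N x *ᵥ w) ⬝ᵥ (N x *ᵥ w) ≤ κ ^ 2 * (w ⬝ᵥ w)) (v : ν → o → ℝ) :
    (∑ x ∈ s, q x • (N x *ᵥ v x)) ⬝ᵥ (∑ x ∈ s, q x • (N x *ᵥ v x)) ≤ κ ^ 2 * ∑ x ∈ s, q x * (v x ⬝ᵥ v x) := by
  classical
  have e : ∑ x ∈ s, q x • (N x *ᵥ v x) = ∑ x ∈ s, q x • ((if q x = 0 then (0 : Matrix o o ℝ) else N x) *ᵥ v x) :=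
    Finset.sum_congr rfl fun x _ => by
      by_cases h : q x = 0
      · rw [h, zero_smul, zero_smul]
      · rw [if_neg h]
  rw [e]
  refine dotProduct_self_wsum_defect_le s hq hq1 (N := fun x => if q x = 0 then (0 : Matrix o o ℝ) else N x) (fun x hx w => ?_) v
  by_cases h : q x = 0
  · simp only [h, if_true, zero_mulVec, dotProduct_zero]
    exact mul_nonneg (sq_nonneg κ) (dotProduct_self_nonneg' w)
  · simp only [if_neg h]
    exact hN x hx h w

/-- **`meanDefect_sq_le_wmoment_local`** — PART 52's polar mass lemma with orthogonality and the pointwise defect asked only where `q_x ≠ 0`: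
`(4 − κ²)|Sc|² ≤ κ²Σ_x q_x|V_xc − a|²`, `S = Σ_x q_x(1 − V_x)` symmetric (truncate `V` to `1` off the support). [our proof] -/
theorem meanDefect_sq_le_wmoment_local {ν : Type*} (s : Finset ν) {q : ν → ℝ} (hq : ∀ x ∈ s, 0 ≤ q x) (hq1 : ∑ x ∈ s, q x = 1)
    {V : ν → Matrix o o ℝ} (hV : ∀ x ∈ s, q x ≠ 0 → (V x)ᵀ * V x = 1) {κ : ℝ}
    (hκ : ∀ x ∈ s, q x ≠ 0 → ∀ w : o → ℝ, (((1 - V x) *ᵥ w) ⬝ᵥ ((1 - V x) *ᵥ w)) ≤ κ ^ 2 * (w ⬝ᵥ w))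
    (hsym : (∑ x ∈ s, q x • (1 - V x))ᵀ = ∑ x ∈ s, q x • (1 - V x)) (c a : o → ℝ) :
    (4 - κ ^ 2) * (((∑ x ∈ s, q x • (1 - V x)) *ᵥ c) ⬝ᵥ ((∑ x ∈ s, q x • (1 - V x)) *ᵥ c)) ≤
      κ ^ 2 * ∑ x ∈ s, q x * ((V x *ᵥ c - a) ⬝ᵥ (V x *ᵥ c - a)) := by
  classical
  -- the truncated family
  have eS : ∑ x ∈ s, q x • (1 - V x) = ∑ x ∈ s, q x • (1 - (if q x = 0 then (1 : Matrix o o ℝ) else V x)) :=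
    Finset.sum_congr rfl fun x _ => by
      by_cases h : q x = 0
      · rw [h, zero_smul, zero_smul]
      · rw [if_neg h]
  have eM : ∑ x ∈ s, q x * ((V x *ᵥ c - a) ⬝ᵥ (V x *ᵥ c - a)) =
      ∑ x ∈ s, q x * (((if q x = 0 then (1 : Matrix o o ℝ) else V x) *ᵥ c - a) ⬝ᵥ ((if q x = 0 then (1 : Matrix o o ℝ) else V x) *ᵥ c - a)) :=
    Finset.sum_congr rfl fun x _ => by
      by_cases h : q x = 0
      · rw [h, zero_mul, zero_mul]
      · rw [if_neg h]
  rw [eS, eM]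
  rw [eS] at hsym
  refine meanDefect_sq_le_wmoment s hq hq1 (V := fun x => if q x = 0 then (1 : Matrix o o ℝ) else V x) (fun x hx => ?_) (fun x hx w => ?_) hsym c a
  · by_cases h : q x = 0
    · simp only [h, if_true, transpose_one, Matrix.one_mul]
    · simp only [if_neg h]; exact hV x hx h
  · by_cases h : q x = 0
    · simp only [h, if_true, sub_self, zero_mulVec, dotProduct_zero]
      exact mul_nonneg (sq_nonneg κ) (dotProduct_self_nonneg' w)
    · simp only [if_neg h]; exact hκ x hx h w

end Tools

/-! ## §2 PART 52's mass-datum bound, support-local -/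

section MassDatum

variable {o μ ν β β' : Type*} [Fintype o] [DecidableEq o] [Fintype μ] [Fintype ν] [Fintype β] [DecidableEq β] [Fintype β']
variable {q : μ → ν → ℝ} {W : μ → ν → Matrix o o ℝ} {Q : Matrix (μ × o) (ν × o) ℝ}
variable {src tgt : β → ν} {R : β → Matrix o o ℝ} {src' tgt' : β' → μ} {R' : β' → Matrix o o ℝ}
variable {Hf : Matrix (ν × o) (ν × o) ℝ} {Hc : Matrix (μ × o) (μ × o) ℝ} {wf wc : ℝ}
variable {σ : β' → ν ≃ ν} {ℓ : ℕ} {xs : β' → ν → ℕ → ν} {γ : β' → ν → ℕ → β} {T : β' → ν → ℕ → Matrix o o ℝ} {m : ℝ}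
variable {N : β' → ν → Matrix o o ℝ} {Φ : (ν × o → ℝ) → μ → ℝ} {Ψ : β' → ℝ} {ϖ κ Z : ℝ}

omit [Fintype μ] in
/-- **`sum_coarseDiff_sq_le_massDatum_local` — PART 52's MASS-DATUM BOUND WITH THE SUPPORT-LOCAL DEFECT LETTER** [our proof; PART 52's proof verbatim,
`hN` entering through §1 `dotProduct_self_wsum_defect_le_local`]: PART 47's setting with the
block-mean-defect letter `κ₂` REPLACED by a per-bond MASS DATUM — for the given field `u`, `|S_{e′}·R′_{e′}(Qu)(tgt′e′)|² ≤ Ψ(e′)`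
(`S_{e′} = Σ_x q(src′e′,x)·N(e′,x)`) with budget `w_c·Σ_{e′}Ψ(e′) ≤ Z` — everything else as in PART 47 (block weights `q ≥ 0`, `Σ_x q(y,x) ≤ 1`,
orthogonal `W, R, R′`, averaging identity `hQ`, fine form bound `hHf`, pairings `σ`, straight chains `xs ∕ γ ∕ T` of length `ℓ` with q-weighted
multiplicity `≤ m`, `w_c·ℓ·m ≤ w_f`, root-frame defects `N` with `|N(e′,x)w|² ≤ κ²|w|²` WHEREVER `q(src′e′,x) ≠ 0`, Poincaré datum `hP ∕ hΦ`).  THEN for all `t, r > 0` the weighted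
coarse bond energy of the block mean obeys `w_c·Σ_{e′}|R′_{e′}(Qu)(tgt′e′) − (Qu)(src′e′)|² ≤ (1 + t + (1+t⁻¹)(1+r)ϖκ²)·⟨u, H_f u⟩ + (1+t⁻¹)(1+r⁻¹)·Z`
(stated on the bond sum, so that a SECOND coarse connection can be compared with `R′` bond by bond — the convention-transfer END of a later PART). -/
theorem sum_coarseDiff_sq_le_massDatum_local
    (hq : ∀ y x, 0 ≤ q y x) (hq1 : ∀ y, ∑ x, q y x ≤ 1) (hW : ∀ y x, (W y x)ᵀ * W y x = 1) (hR : ∀ e, (R e)ᵀ * R e = 1)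
    (hR' : ∀ e', (R' e')ᵀ * R' e' = 1)
    (hQ : ∀ (u : ν × o → ℝ) (y : μ), (fun a => (Q *ᵥ u) (y, a)) = ∑ x, q y x • (W y x *ᵥ fun b => u (x, b)))
    (hwc : 0 ≤ wc)
    (hHf : ∀ u : ν × o → ℝ, wf * ∑ e, ((R e *ᵥ fun b => u (tgt e, b)) - fun b => u (src e, b)) ⬝ᵥ
        ((R e *ᵥ fun b => u (tgt e, b)) - fun b => u (src e, b)) ≤ u ⬝ᵥ (Hf *ᵥ u))
    (hσq : ∀ e' x, q (tgt' e') (σ e' x) = q (src' e') x)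
    (hx0 : ∀ e' x, xs e' x 0 = x) (hxℓ : ∀ e' x, xs e' x ℓ = σ e' x)
    (hsrc : ∀ e' x i, i < ℓ → src (γ e' x i) = xs e' x i) (htgt : ∀ e' x i, i < ℓ → tgt (γ e' x i) = xs e' x (i + 1))
    (hT0 : ∀ e' x, T e' x 0 = 1) (hT : ∀ e' x i, i < ℓ → T e' x (i + 1) = T e' x i * R (γ e' x i))
    (hmult : ∀ e, ∑ e', ∑ x, ∑ i ∈ range ℓ, (if γ e' x i = e then q (src' e') x else 0) ≤ m)
    (hw : wc * ℓ * m ≤ wf)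
    (hNdef : ∀ e' x, N e' x = 1 - W (src' e') x * T e' x ℓ * (W (tgt' e') (σ e' x))ᵀ * (R' e')ᵀ)
    (hN : ∀ e' x, q (src' e') x ≠ 0 → ∀ w : o → ℝ, (N e' x *ᵥ w) ⬝ᵥ (N e' x *ᵥ w) ≤ κ ^ 2 * (w ⬝ᵥ w))
    (u : ν × o → ℝ)
    (hP : ∀ y, ∑ x, q y x * (((W y x *ᵥ fun b => u (x, b)) - fun a => (Q *ᵥ u) (y, a)) ⬝ᵥ
        ((W y x *ᵥ fun b => u (x, b)) - fun a => (Q *ᵥ u) (y, a))) ≤ Φ u y)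
    (hΦ : wc * ∑ e', Φ u (tgt' e') ≤ ϖ * (u ⬝ᵥ (Hf *ᵥ u)))
    (hS : ∀ e', ((∑ x, q (src' e') x • N e' x) *ᵥ (R' e' *ᵥ fun a => (Q *ᵥ u) (tgt' e', a))) ⬝ᵥ
        ((∑ x, q (src' e') x • N e' x) *ᵥ (R' e' *ᵥ fun a => (Q *ᵥ u) (tgt' e', a))) ≤ Ψ e')
    (hΨ : wc * ∑ e', Ψ e' ≤ Z)
    {t r : ℝ} (ht : 0 < t) (hr : 0 < r) :
    wc * ∑ e', ((R' e' *ᵥ fun a => (Q *ᵥ u) (tgt' e', a)) - fun a => (Q *ᵥ u) (src' e', a)) ⬝ᵥ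
        ((R' e' *ᵥ fun a => (Q *ᵥ u) (tgt' e', a)) - fun a => (Q *ᵥ u) (src' e', a)) ≤
      (1 + t + (1 + t⁻¹) * (1 + r) * ϖ * κ ^ 2) * (u ⬝ᵥ (Hf *ᵥ u)) + (1 + t⁻¹) * (1 + r⁻¹) * Z := by
  set F : β → ℝ := fun e => ((R e *ᵥ fun b => u (tgt e, b)) - fun b => u (src e, b)) ⬝ᵥ
    ((R e *ᵥ fun b => u (tgt e, b)) - fun b => u (src e, b)) with hF
  have hF0 : ∀ e, 0 ≤ F e := fun e => dotProduct_self_nonneg' _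
  have ht' : (0 : ℝ) ≤ 1 + t⁻¹ := by positivity
  have hr' : (0 : ℝ) ≤ 1 + r⁻¹ := by positivity
  have hr1 : (0 : ℝ) ≤ 1 + r := by positivity
  -- per coarse bond: the three-term split; (A) and (B) as in PART 47, (C) by the mass datum
  have hper : ∀ e',
      ((R' e' *ᵥ fun a => (Q *ᵥ u) (tgt' e', a)) - fun a => (Q *ᵥ u) (src' e', a)) ⬝ᵥ
          ((R' e' *ᵥ fun a => (Q *ᵥ u) (tgt' e', a)) - fun a => (Q *ᵥ u) (src' e', a)) ≤
        (1 + t) * (ℓ * ∑ x, q (src' e') x * ∑ i ∈ range ℓ, F (γ e' x i)) +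
          (1 + t⁻¹) * ((1 + r) * (κ ^ 2 * Φ u (tgt' e')) + (1 + r⁻¹) * Ψ e') := by
    intro e'
    have hSe := hS e'
    set c : o → ℝ := R' e' *ᵥ fun a => (Q *ᵥ u) (tgt' e', a) with hc
    rw [coarseDiff_avg_eq_three hQ (hR' e') (fun x => hW (tgt' e') x) (σ e') (hσq e') (fun x => T e' x ℓ) (fun x => hNdef e' x) c u]
    refine (dotProduct_self_add_add_le _ _ _ ht hr).trans ?_
    refine add_le_add ?_ (mul_le_mul_of_nonneg_left (add_le_add ?_ (mul_le_mul_of_nonneg_left hSe hr')) ht')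
    · -- (A) the chain term
      refine mul_le_mul_of_nonneg_left ?_ (by linarith)
      refine (dotProduct_self_wsum_le Finset.univ (fun x _ => hq _ x) (hq1 _) (fun x _ => hW (src' e') x) _).trans ?_
      rw [Finset.mul_sum]
      refine Finset.sum_le_sum fun x _ => ?_
      have h := dotProduct_self_chain_le (R := fun i => R (γ e' x i)) (T := T e' x) (fun i _ => hR _) (hT0 e' x)
        (fun i hi => hT e' x i hi) (fun i => fun b => u (xs e' x i, b))
      rw [hxℓ, hx0] at h
      have hs : ∑ i ∈ range ℓ, F (γ e' x i) =
          ∑ i ∈ range ℓ, ((R (γ e' x i) *ᵥ fun b => u (xs e' x (i + 1), b)) - fun b => u (xs e' x i, b)) ⬝ᵥ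
            ((R (γ e' x i) *ᵥ fun b => u (xs e' x (i + 1), b)) - fun b => u (xs e' x i, b)) :=
        Finset.sum_congr rfl fun i hi => by simp only [hF]; rw [hsrc e' x i (mem_range.mp hi), htgt e' x i (mem_range.mp hi)]
      rw [hs]
      calc q (src' e') x * ((T e' x ℓ *ᵥ (fun b => u (σ e' x, b)) - fun b => u (x, b)) ⬝ᵥ
              (T e' x ℓ *ᵥ (fun b => u (σ e' x, b)) - fun b => u (x, b)))
          ≤ q (src' e') x * (ℓ * ∑ i ∈ range ℓ, ((R (γ e' x i) *ᵥ fun b => u (xs e' x (i + 1), b)) - fun b => u (xs e' x i, b)) ⬝ᵥ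
              ((R (γ e' x i) *ᵥ fun b => u (xs e' x (i + 1), b)) - fun b => u (xs e' x i, b))) :=
            mul_le_mul_of_nonneg_left h (hq _ x)
        _ = ℓ * (q (src' e') x * ∑ i ∈ range ℓ, ((R (γ e' x i) *ᵥ fun b => u (xs e' x (i + 1), b)) - fun b => u (xs e' x i, b)) ⬝ᵥ
              ((R (γ e' x i) *ᵥ fun b => u (xs e' x (i + 1), b)) - fun b => u (xs e' x i, b))) := by ring
    · -- (B) pointwise defects against the fluctuation
      refine mul_le_mul_of_nonneg_left ?_ hr1
      refine (dotProduct_self_wsum_defect_le_local Finset.univ (fun x _ => hq _ x) (hq1 _) (fun x _ hx w => hN e' x hx w) _).trans ?_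
      refine mul_le_mul_of_nonneg_left ?_ (sq_nonneg κ)
      have hre : ∀ x, ((R' e' *ᵥ (W (tgt' e') (σ e' x) *ᵥ fun b => u (σ e' x, b))) - c) ⬝ᵥ
            ((R' e' *ᵥ (W (tgt' e') (σ e' x) *ᵥ fun b => u (σ e' x, b))) - c) =
          ((W (tgt' e') (σ e' x) *ᵥ fun b => u (σ e' x, b)) - fun a => (Q *ᵥ u) (tgt' e', a)) ⬝ᵥ
            ((W (tgt' e') (σ e' x) *ᵥ fun b => u (σ e' x, b)) - fun a => (Q *ᵥ u) (tgt' e', a)) := fun x => by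
        rw [hc, ← mulVec_sub, self_of_orthogonal (hR' e')]
      simp_rw [hre, ← hσq e']
      rw [Equiv.sum_comp (σ e') (fun x => q (tgt' e') x *
        (((W (tgt' e') x *ᵥ fun b => u (x, b)) - fun a => (Q *ᵥ u) (tgt' e', a)) ⬝ᵥ
          ((W (tgt' e') x *ᵥ fun b => u (x, b)) - fun a => (Q *ᵥ u) (tgt' e', a))))]
      exact hP (tgt' e')
  -- sum over the coarse bonds
  have hsum : ∑ e', ((R' e' *ᵥ fun a => (Q *ᵥ u) (tgt' e', a)) - fun a => (Q *ᵥ u) (src' e', a)) ⬝ᵥ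
          ((R' e' *ᵥ fun a => (Q *ᵥ u) (tgt' e', a)) - fun a => (Q *ᵥ u) (src' e', a)) ≤
        (1 + t) * (ℓ * ∑ e', ∑ x, q (src' e') x * ∑ i ∈ range ℓ, F (γ e' x i)) +
          (1 + t⁻¹) * ((1 + r) * (κ ^ 2 * ∑ e', Φ u (tgt' e')) + (1 + r⁻¹) * ∑ e', Ψ e') := by
    refine (Finset.sum_le_sum fun e' _ => hper e').trans (le_of_eq ?_)
    simp only [Finset.sum_add_distrib, ← Finset.mul_sum]
  have hmu := sum_chain_le_of_multiplicity q src' γ ℓ hmult F hF0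
  have hSF : 0 ≤ ∑ e, F e := Finset.sum_nonneg fun e _ => hF0 e
  have hHfu := hHf u
  refine (mul_le_mul_of_nonneg_left hsum hwc).trans ?_
  have h1 : wc * ((1 + t) * (ℓ * ∑ e', ∑ x, q (src' e') x * ∑ i ∈ range ℓ, F (γ e' x i))) ≤ (1 + t) * (u ⬝ᵥ (Hf *ᵥ u)) := by
    have a1 : wc * ((1 + t) * (ℓ * ∑ e', ∑ x, q (src' e') x * ∑ i ∈ range ℓ, F (γ e' x i))) ≤ wc * ((1 + t) * (ℓ * (m * ∑ e, F e))) :=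
      mul_le_mul_of_nonneg_left (mul_le_mul_of_nonneg_left (mul_le_mul_of_nonneg_left hmu (Nat.cast_nonneg _)) (by linarith)) hwc
    have a2 : wc * ((1 + t) * (ℓ * (m * ∑ e, F e))) = (1 + t) * ((wc * ℓ * m) * ∑ e, F e) := by ring
    have a3 : (wc * ℓ * m) * ∑ e, F e ≤ u ⬝ᵥ (Hf *ᵥ u) := (mul_le_mul_of_nonneg_right hw hSF).trans hHfu
    rw [a2] at a1
    exact a1.trans (mul_le_mul_of_nonneg_left a3 (by linarith))
  have h2 : wc * ((1 + t⁻¹) * ((1 + r) * (κ ^ 2 * ∑ e', Φ u (tgt' e')))) ≤ (1 + t⁻¹) * (1 + r) * ϖ * κ ^ 2 * (u ⬝ᵥ (Hf *ᵥ u)) := by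
    have : wc * ((1 + t⁻¹) * ((1 + r) * (κ ^ 2 * ∑ e', Φ u (tgt' e')))) = (1 + t⁻¹) * (1 + r) * κ ^ 2 * (wc * ∑ e', Φ u (tgt' e')) := by ring
    rw [this]
    have := mul_le_mul_of_nonneg_left hΦ (show (0 : ℝ) ≤ (1 + t⁻¹) * (1 + r) * κ ^ 2 by positivity)
    linarith [this]
  have h3 : wc * ((1 + t⁻¹) * ((1 + r⁻¹) * ∑ e', Ψ e')) ≤ (1 + t⁻¹) * (1 + r⁻¹) * Z := by
    have : wc * ((1 + t⁻¹) * ((1 + r⁻¹) * ∑ e', Ψ e')) = (1 + t⁻¹) * (1 + r⁻¹) * (wc * ∑ e', Ψ e') := by ring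
    rw [this]
    exact mul_le_mul_of_nonneg_left hΨ (by positivity)
  have split : wc * ((1 + t) * (ℓ * ∑ e', ∑ x, q (src' e') x * ∑ i ∈ range ℓ, F (γ e' x i)) +
        (1 + t⁻¹) * ((1 + r) * (κ ^ 2 * ∑ e', Φ u (tgt' e')) + (1 + r⁻¹) * ∑ e', Ψ e')) =
      wc * ((1 + t) * (ℓ * ∑ e', ∑ x, q (src' e') x * ∑ i ∈ range ℓ, F (γ e' x i))) +
        (wc * ((1 + t⁻¹) * ((1 + r) * (κ ^ 2 * ∑ e', Φ u (tgt' e')))) + wc * ((1 + t⁻¹) * ((1 + r⁻¹) * ∑ e', Ψ e'))) := by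
    ring
  rw [split]
  linarith [h1, h2, h3]

end MassDatum

/-! ## §3 PART 53's polar mass datum, support-local -/

section PolarDatum

variable {o μ ν β β' : Type*} [Fintype o] [DecidableEq o] [Fintype μ] [Fintype ν] [Fintype β] [DecidableEq β] [Fintype β']
variable {q : μ → ν → ℝ} {W : μ → ν → Matrix o o ℝ} {Q : Matrix (μ × o) (ν × o) ℝ}
variable {src tgt : β → ν} {R : β → Matrix o o ℝ} {src' tgt' : β' → μ} {R' : β' → Matrix o o ℝ}
variable {σ : β' → ν ≃ ν} {ℓ : ℕ} {xs : β' → ν → ℕ → ν} {γ : β' → ν → ℕ → β} {T : β' → ν → ℕ → Matrix o o ℝ}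
variable {N : β' → ν → Matrix o o ℝ} {Φ : (ν × o → ℝ) → μ → ℝ} {κ : ℝ}

omit [Fintype μ] [Fintype β] [DecidableEq β] [Fintype β'] in
/-- **`massDatum_polar_le_local` — PART 53's POLAR MASS DATUM WITH THE SUPPORT-LOCAL DEFECT LETTER** [our proof; PART 53's proof verbatim, `hN`
entering through §1 `meanDefect_sq_le_wmoment_local`].  One coarse bond `e′ = (y → y′)` of PART 47's setting with `Σ_x q(y,x) = 1`,
`R′_{e′}` orthogonal, the POLAR letter «`S_{e′} = Σ_x q(y,x)·N(e′,x)` symmetric» and `κ² < 4`: with `b̄ = (Qu)(y′)`,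
`|S_{e′}·R′b̄|² ≤ 3κ²∕(4 − κ²)·[Σ_x q(y′,x)|W(y′,x)u(x) − b̄|² + ℓ·Σ_x q(y,x)Σ_{i<ℓ}|D_{γ(e′,x,i)}u|² + Σ_x q(y,x)|W(y,x)u(x) − (Qu)(y)|²]`
(the polar mass lemma with centre `(Qu)(y)`; each `V_xR′b̄ − (Qu)(y)` telescopes through `u(σx)` and `u(x)` into a Poincaré fluctuation at `y′`, a
transported chain of fine differences and a Poincaré fluctuation at `y`). -/
theorem massDatum_polar_le_local
    (hq : ∀ y x, 0 ≤ q y x) (hq1 : ∀ y, ∑ x, q y x = 1) (hW : ∀ y x, (W y x)ᵀ * W y x = 1) (hR : ∀ e, (R e)ᵀ * R e = 1)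
    (hR' : ∀ e', (R' e')ᵀ * R' e' = 1)
    (hσq : ∀ e' x, q (tgt' e') (σ e' x) = q (src' e') x)
    (hx0 : ∀ e' x, xs e' x 0 = x) (hxℓ : ∀ e' x, xs e' x ℓ = σ e' x)
    (hsrc : ∀ e' x i, i < ℓ → src (γ e' x i) = xs e' x i) (htgt : ∀ e' x i, i < ℓ → tgt (γ e' x i) = xs e' x (i + 1))
    (hT0 : ∀ e' x, T e' x 0 = 1) (hT : ∀ e' x i, i < ℓ → T e' x (i + 1) = T e' x i * R (γ e' x i))
    (hNdef : ∀ e' x, N e' x = 1 - W (src' e') x * T e' x ℓ * (W (tgt' e') (σ e' x))ᵀ * (R' e')ᵀ)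
    (hN : ∀ e' x, q (src' e') x ≠ 0 → ∀ w : o → ℝ, (N e' x *ᵥ w) ⬝ᵥ (N e' x *ᵥ w) ≤ κ ^ 2 * (w ⬝ᵥ w))
    (hsym : ∀ e', (∑ x, q (src' e') x • N e' x)ᵀ = ∑ x, q (src' e') x • N e' x) (hκ : κ ^ 2 < 4)
    (u : ν × o → ℝ) (e' : β') :
    ((∑ x, q (src' e') x • N e' x) *ᵥ (R' e' *ᵥ fun a => (Q *ᵥ u) (tgt' e', a))) ⬝ᵥ
        ((∑ x, q (src' e') x • N e' x) *ᵥ (R' e' *ᵥ fun a => (Q *ᵥ u) (tgt' e', a))) ≤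
      3 * κ ^ 2 / (4 - κ ^ 2) *
        (∑ x, q (tgt' e') x * (((W (tgt' e') x *ᵥ fun b => u (x, b)) - fun a => (Q *ᵥ u) (tgt' e', a)) ⬝ᵥ
            ((W (tgt' e') x *ᵥ fun b => u (x, b)) - fun a => (Q *ᵥ u) (tgt' e', a))) +
          ℓ * ∑ x, q (src' e') x * ∑ i ∈ range ℓ,
            ((R (γ e' x i) *ᵥ fun b => u (tgt (γ e' x i), b)) - fun b => u (src (γ e' x i), b)) ⬝ᵥ
              ((R (γ e' x i) *ᵥ fun b => u (tgt (γ e' x i), b)) - fun b => u (src (γ e' x i), b)) +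
          ∑ x, q (src' e') x * (((W (src' e') x *ᵥ fun b => u (x, b)) - fun a => (Q *ᵥ u) (src' e', a)) ⬝ᵥ
            ((W (src' e') x *ᵥ fun b => u (x, b)) - fun a => (Q *ᵥ u) (src' e', a)))) := by
  -- abbreviations
  set y := src' e' with hy
  set y' := tgt' e' with hy'
  set bbar : o → ℝ := fun a => (Q *ᵥ u) (y', a) with hbbar
  set abar : o → ℝ := fun a => (Q *ᵥ u) (y, a) with habar
  set V : ν → Matrix o o ℝ := fun x => W y x * T e' x ℓ * (W y' (σ e' x))ᵀ * (R' e')ᵀ with hVdef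
  have hTl : ∀ x, (T e' x ℓ)ᵀ * T e' x ℓ = 1 := fun x =>
    orthogonal_partialTransport (R := fun i => R (γ e' x i)) (fun i _ => hR _) (hT0 e' x) (fun i hi => hT e' x i hi) ℓ le_rfl
  have hVo : ∀ x, (V x)ᵀ * V x = 1 := fun x =>
    orthogonal_mul (orthogonal_mul (orthogonal_mul (hW _ _) (hTl x)) (transpose_orthogonal (hW _ _))) (transpose_orthogonal (hR' e'))
  have hNV : ∀ x, N e' x = 1 - V x := fun x => by rw [hNdef e' x]
  -- Step A: the polar mass lemma with centre `(Qu)(y)`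
  have hsymV : (∑ x, q y x • (1 - V x))ᵀ = ∑ x, q y x • (1 - V x) := by
    have hs := hsym e'; simp_rw [hNV] at hs; exact hs
  have hκV : ∀ x ∈ (Finset.univ : Finset ν), q y x ≠ 0 → ∀ w : o → ℝ, (((1 - V x) *ᵥ w) ⬝ᵥ ((1 - V x) *ᵥ w)) ≤ κ ^ 2 * (w ⬝ᵥ w) :=
    fun x _ hx w => by rw [← hNV x]; exact hN e' x hx w
  have hA := meanDefect_sq_le_wmoment_local Finset.univ (fun x _ => hq y x) (hq1 y) (fun x _ _ => hVo x) hκV hsymV (R' e' *ᵥ bbar) abar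
  simp_rw [← hNV] at hA
  -- Step B: `V_x R′b̄ − (Qu)(y)` telescopes through `u(σx)`, `u(x)`
  have hB : ∀ x, (V x *ᵥ (R' e' *ᵥ bbar) - abar) ⬝ᵥ (V x *ᵥ (R' e' *ᵥ bbar) - abar) ≤
      3 * ((((W y' (σ e' x) *ᵥ fun b => u (σ e' x, b)) - bbar) ⬝ᵥ ((W y' (σ e' x) *ᵥ fun b => u (σ e' x, b)) - bbar)) +
        ((T e' x ℓ *ᵥ (fun b => u (σ e' x, b)) - fun b => u (x, b)) ⬝ᵥ (T e' x ℓ *ᵥ (fun b => u (σ e' x, b)) - fun b => u (x, b))) +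
        (((W y x *ᵥ fun b => u (x, b)) - abar) ⬝ᵥ ((W y x *ᵥ fun b => u (x, b)) - abar))) := by
    intro x
    have hWWt : (W y' (σ e' x))ᵀ * W y' (σ e' x) = 1 := hW _ _
    have e1 : V x *ᵥ (R' e' *ᵥ bbar) = W y x *ᵥ (T e' x ℓ *ᵥ ((W y' (σ e' x))ᵀ *ᵥ bbar)) := by
      simp only [hVdef, mulVec_mulVec]
      congr 1
      calc W y x * T e' x ℓ * (W y' (σ e' x))ᵀ * (R' e')ᵀ * R' e'
          = W y x * (T e' x ℓ * (W y' (σ e' x))ᵀ) * ((R' e')ᵀ * R' e') := by simp only [Matrix.mul_assoc]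
        _ = W y x * (T e' x ℓ * (W y' (σ e' x))ᵀ) := by rw [hR' e', Matrix.mul_one]
    have e2 : V x *ᵥ (R' e' *ᵥ bbar) - abar =
        W y x *ᵥ (T e' x ℓ *ᵥ (((W y' (σ e' x))ᵀ *ᵥ bbar) - fun b => u (σ e' x, b))) +
          W y x *ᵥ (T e' x ℓ *ᵥ (fun b => u (σ e' x, b)) - fun b => u (x, b)) +
          ((W y x *ᵥ fun b => u (x, b)) - abar) := by
      rw [e1, mulVec_sub, mulVec_sub, mulVec_sub]; abel
    rw [e2]
    refine (dotProduct_self_add_add_le_three _ _ _).trans (le_of_eq ?_)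
    congr 2
    · congr 1
      · rw [self_of_orthogonal (hW y x), self_of_orthogonal (hTl x)]
        -- `|W′ᵀb̄ − u(σx)|² = |W′u(σx) − b̄|²`
        have e3 : ((W y' (σ e' x))ᵀ *ᵥ bbar) - (fun b => u (σ e' x, b)) =
            -((W y' (σ e' x))ᵀ *ᵥ ((W y' (σ e' x) *ᵥ fun b => u (σ e' x, b)) - bbar)) := by
          rw [mulVec_sub, mulVec_mulVec, hWWt, one_mulVec]; abel
        rw [e3, neg_dotProduct, dotProduct_neg, neg_neg, self_of_orthogonal (transpose_orthogonal hWWt)]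
      · rw [self_of_orthogonal (hW y x)]
  -- Step C: sum with the weights `q(y,·)`; the chain bound; reindex the `y′`-fluctuation by `σ`
  have hC : ∑ x, q y x * ((V x *ᵥ (R' e' *ᵥ bbar) - abar) ⬝ᵥ (V x *ᵥ (R' e' *ᵥ bbar) - abar)) ≤
      3 * (∑ x, q y' x * (((W y' x *ᵥ fun b => u (x, b)) - bbar) ⬝ᵥ ((W y' x *ᵥ fun b => u (x, b)) - bbar)) +
        ℓ * ∑ x, q y x * ∑ i ∈ range ℓ,
          ((R (γ e' x i) *ᵥ fun b => u (tgt (γ e' x i), b)) - fun b => u (src (γ e' x i), b)) ⬝ᵥ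
            ((R (γ e' x i) *ᵥ fun b => u (tgt (γ e' x i), b)) - fun b => u (src (γ e' x i), b)) +
        ∑ x, q y x * (((W y x *ᵥ fun b => u (x, b)) - abar) ⬝ᵥ ((W y x *ᵥ fun b => u (x, b)) - abar))) := by
    have hfl : ∑ x, q y x * ((((W y' (σ e' x) *ᵥ fun b => u (σ e' x, b)) - bbar) ⬝ᵥ ((W y' (σ e' x) *ᵥ fun b => u (σ e' x, b)) - bbar))) =
        ∑ x, q y' x * (((W y' x *ᵥ fun b => u (x, b)) - bbar) ⬝ᵥ ((W y' x *ᵥ fun b => u (x, b)) - bbar)) := by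
      simp_rw [hy, hy', ← hσq e']
      exact Equiv.sum_comp (σ e') (fun x => q (tgt' e') x *
        (((W (tgt' e') x *ᵥ fun b => u (x, b)) - bbar) ⬝ᵥ ((W (tgt' e') x *ᵥ fun b => u (x, b)) - bbar)))
    have hch : ∀ x, q y x * (((T e' x ℓ *ᵥ (fun b => u (σ e' x, b)) - fun b => u (x, b)) ⬝ᵥ
        (T e' x ℓ *ᵥ (fun b => u (σ e' x, b)) - fun b => u (x, b)))) ≤
        q y x * (ℓ * ∑ i ∈ range ℓ, ((R (γ e' x i) *ᵥ fun b => u (tgt (γ e' x i), b)) - fun b => u (src (γ e' x i), b)) ⬝ᵥ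
          ((R (γ e' x i) *ᵥ fun b => u (tgt (γ e' x i), b)) - fun b => u (src (γ e' x i), b))) := by
      intro x
      refine mul_le_mul_of_nonneg_left ?_ (hq y x)
      have h := dotProduct_self_chain_le (R := fun i => R (γ e' x i)) (T := T e' x) (fun i _ => hR _) (hT0 e' x)
        (fun i hi => hT e' x i hi) (fun i => fun b => u (xs e' x i, b))
      rw [hxℓ, hx0] at h
      refine h.trans (le_of_eq ?_)
      congr 1
      exact Finset.sum_congr rfl fun i hi => by rw [hsrc e' x i (mem_range.mp hi), htgt e' x i (mem_range.mp hi)]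
    calc ∑ x, q y x * ((V x *ᵥ (R' e' *ᵥ bbar) - abar) ⬝ᵥ (V x *ᵥ (R' e' *ᵥ bbar) - abar))
        ≤ ∑ x, q y x * (3 * ((((W y' (σ e' x) *ᵥ fun b => u (σ e' x, b)) - bbar) ⬝ᵥ ((W y' (σ e' x) *ᵥ fun b => u (σ e' x, b)) - bbar)) +
            ((T e' x ℓ *ᵥ (fun b => u (σ e' x, b)) - fun b => u (x, b)) ⬝ᵥ (T e' x ℓ *ᵥ (fun b => u (σ e' x, b)) - fun b => u (x, b))) +
            (((W y x *ᵥ fun b => u (x, b)) - abar) ⬝ᵥ ((W y x *ᵥ fun b => u (x, b)) - abar)))) :=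
          Finset.sum_le_sum fun x _ => mul_le_mul_of_nonneg_left (hB x) (hq y x)
      _ = 3 * (∑ x, q y x * ((((W y' (σ e' x) *ᵥ fun b => u (σ e' x, b)) - bbar) ⬝ᵥ ((W y' (σ e' x) *ᵥ fun b => u (σ e' x, b)) - bbar))) +
            ∑ x, q y x * (((T e' x ℓ *ᵥ (fun b => u (σ e' x, b)) - fun b => u (x, b)) ⬝ᵥ
              (T e' x ℓ *ᵥ (fun b => u (σ e' x, b)) - fun b => u (x, b)))) +
            ∑ x, q y x * (((W y x *ᵥ fun b => u (x, b)) - abar) ⬝ᵥ ((W y x *ᵥ fun b => u (x, b)) - abar))) := by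
          rw [← Finset.sum_add_distrib, ← Finset.sum_add_distrib, Finset.mul_sum]
          exact Finset.sum_congr rfl fun x _ => by ring
      _ ≤ _ := by
          rw [hfl]
          refine mul_le_mul_of_nonneg_left (add_le_add (add_le_add le_rfl ?_) le_rfl) (by norm_num)
          rw [Finset.mul_sum]
          refine Finset.sum_le_sum fun x _ => (hch x).trans (le_of_eq ?_)
          ring
  -- assemble: `(4 − κ²)|S c̄|² ≤ κ²·(Step C)`, divide by `4 − κ² > 0`
  have h4 : 0 < 4 - κ ^ 2 := by linarith
  have hκ2 : 0 ≤ κ ^ 2 := sq_nonneg κ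
  have hAC := hA.trans (mul_le_mul_of_nonneg_left hC hκ2)
  have hdiv := (le_div_iff₀ h4).mpr ((mul_comm _ _).trans_le hAC)
  refine hdiv.trans (le_of_eq ?_)
  ring

end PolarDatum

end Summit.QuantumFields.BalabanUV.Beta.GAN24.DerivativeRateTransferJensenMassFreeLocal

end
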